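import Summits.HodgeConjecture.HodgeConjecture.Theorems.F0LD2LineThetaTypesComplementaryDefs
import Summits.HodgeConjecture.HodgeConjecture.Theorems.F0P2oU1DichotomyTransport
import Literature.NumberTheory.Automorphic.Liu2021.LemD1Item1AtV2AnisotropicDichotomy
import Literature.RepresentationTheory.MoeglinVignerasWaldspurger1987.RankOneThetaDichotomy
import Literature.RepresentationTheory.CompactAbelianTypeDichotomyOfDisjoint
import HarnessLib

/-!
# LD2 organ road (π1): the rank-one organ `LineThetaTypesComplementary₁` («the two same-`λ` line theta representations have
# COMPLEMENTARY type sets») FROM DISJOINTNESS («no open-kernel character occurs in both») — theorems only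

Cell `hodgecm-mathlib`, half A line LD2 (socket `stub_S1b_facts` of `Cruxes/HLiu418/Lines/F0_AlbCm`, books row #74R; leaf
`Cruxes/HLiu418/Lines/F0_P6LD_StubS1bFactsOrganRoad.lean` ED. 6, organ stub `stub_organ_lineTypes₁`), seat A-p19 (g30), 2026-09-02; LD2-plan (g2)
ROAD LEDGER 08:46:22Z item (π1) «DISJOINT ⇒ ORGAN, glue M, unassigned».  THEOREMS ONLY (no `def`, no named fact, no instance, no notation,
no `sorry`); `--supports stmt-HodgeConjecture-24832`.

WHAT IS PROVED.  The organ of ★ `F0LD2LineThetaTypesComplementaryDefs` says: at a non-split `v` where the Step-1 representatives `ε(aδ)`,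
`ε(a′δ)` of the two hermitian lines are in different norm classes, `dim ω_{s_{a′}}[ξ] + dim ω_{s_a}[ξ] = 1` for every open-kernel character `ξ` of
the compact torus `U(diag dV₁)(L⁺_v) = L_v¹` (the two RANK-ONE line-model CM θ-package sections of A-p19's token contract `RANK1-SECTION-shape`).  This
file reduces it to DISJOINTNESS — `dim ω_{s_{a′}}[ξ] = 0 ∨ dim ω_{s_a}[ξ] = 0` for every open-kernel `ξ` — i.e. to «no character of `L_v¹` occurs in
both line representations», which is the target of the (π2) road ((P) ⟹ DISJOINT: B-p04 (g44)'s doubling relation ★ `LocalDoubledBlockTypesDuality` +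
transports) and of the soft road (π3).
* §1 `finrank_weightSpace_add_eq_one_of_disjoint_lines` — GENERIC `E/F`, two splitting families `𝓢₁, 𝓢₂` of the rank-(1,1) pairs `(J_V, (a₁))`,
  `(J_V, (a₂))` with `(d, a₂a₁⁻¹)_v = −1`, non-split `v`: disjointness of the type sets of the two `e′_a`-transported δ-model carriers (★
  `lineTransportSection`) in the OPEN-KERNEL-`ξ` currency ⟹ `dim ω_{s₁}[ξ] + dim ω_{s₂}[ξ] = 1`.  Proof = [MVW87 Chap. 3 §IV.4] SHIFTED dichotomy ★
  `rankOne_theta_dichotomy` (`dim ω_{s₁}[ξ] + dim ω_{s₂}[ξθ] = 1` for SOME open-kernel `θ`) + the shift removal ★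
  `TwistedCoinv.finrank_weightSpace_add_eq_one_of_shift_of_disjoint` (`θ` has finite order on the compact torus; disjointness makes the type set
  `θ`-stable).  This is the open-kernel-`ξ` twin of ★ `F0P2oU1DichotomyTransport.finrank_weightSpace_add_eq_one_of_disjoint` (H413 side, `ψ ∘ det`
  currency), whose class-sign bookkeeping is repeated verbatim.
* §2 `not_isNorm_of_eps_guard` — the letter's GUARD «`ε(aδ) ≠ x x̄ ε(a′δ)` for all `x ∈ L_vˣ`» (★ `LemD1OfPlace.eps`, `ε(xδ) = x⁻¹δ ⊗ 1`) says
  `a⁻¹a′` is not a norm from `L_v`; with ★ `F0P2oU1DichotomyTransport.hilbertSymbol_eq_neg_one_of_not_isNorm` [O'Meara 63:10] this is the class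
  sign `(d, a′a⁻¹)_v = −1`.
* §3 `finrank_add_eq_one_of_disjoint_cm` — §1 on the CM tokens of the organ (frame `diag dV₁`, `δ = imagUnit L`, families = the `λ`-normalised
  Kudla splittings ★ `undoubledSplittings` on the two lines, `L_v` a field by ★ `isField_localRing_cm_of_forall_smul_eq`): the organ's body at `v`
  from disjointness at `v`; `lineThetaTypesComplementary₁_of_disjoint` — the closed form «(disjointness at every guarded non-split place) ⟹
  `LineThetaTypesComplementary₁`», hypothesis spelled out in the organ's tokens (no new definition); and the same two heads with disjointness read in
  COINVARIANT currency (`finrank_add_eq_one_of_coinv_disjoint_cm`, `lineThetaTypesComplementary₁_of_coinv_disjoint`; §1 `…_of_coinv_disjoint_lines`),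
  the language of ★ `LocalDoubledBlockTypesDuality` — coinvariants = weight spaces for the smooth carriers of the compact torus (★
  `exists_linearEquiv_weightSpace_coinv`).

HONEST LABEL.  Nothing of print is asserted; the organ is NOT paid here (its price becomes exactly «disjointness»).  HC_CM is proved only modulo the
7 printed citations (2 remaining named inputs: hLiu418 = stmt-HodgeConjecture-24832, h413 = stmt-HodgeConjecture-24833) until rung 0 closes; count-neutral.

## References
* [MoeglinVignerasWaldspurger1987] C. Mœglin, M.-F. Vignéras, J.-L. Waldspurger, LNM 1291 (1987), Chap. 3 §IV.4 Théorème principal; Chap. 2 II.1 (A).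
* [HarrisKudlaSweet1996] M. Harris, S. Kudla, W. J. Sweet, J. AMS 9 (1996), Cor. 4.4 p. 962 (m = n = 1), Thm. 6.1.
* [Omeara1963] O. T. O'Meara, *Introduction to Quadratic Forms* (1963), §63B (63:10).
* [Liu2021] Y. Liu, Camb. J. Math. 9 (2021) = arXiv:2102.11518, App. D §D.1 Step 1 (l. 5217), Lemma D.1 (4) (p. 126).
* [BernsteinZelevinsky1976] I. N. Bernstein, A. V. Zelevinsky, Russian Math. Surveys 31 (1976), §2.1.
-/

set_option autoImplicit false
set_option linter.dupNamespace false

noncomputable section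

open scoped Matrix Kronecker
open NumberField IsDedekindDomain MeasureTheory
open Literature.NumberTheory Literature.NumberTheory.Automorphic Literature.NumberTheory.Automorphic.UnitaryGroup
open Literature.RepresentationTheory Literature.RepresentationTheory.HeisenbergGroup Literature.RepresentationTheory.TwistedCoinv
open Literature.NumberTheory.GelbartRogawski1991 Literature.NumberTheory.GelbartRogawski1991.UnitaryDualPair
open Literature.NumberTheory.GelbartRogawski1991.UnitaryDualPair.WeilCoinv
open Literature.NumberTheory.GelbartRogawski1991.UnitaryDualPair.LocalSplitting
open Literature.NumberTheory.GelbartRogawski1991.GRConstruction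
open Literature.NumberTheory.Weil1964
open Literature.NumberTheory.GaloisRepresentations Literature.RepresentationTheory.HarrisKudlaSweet1996
open Literature.NumberTheory.Automorphic.IdeleClassGroup Literature.RepresentationTheory.Liu2021
open Literature.NumberTheory.Automorphic.Liu2021 Literature.NumberTheory.Automorphic.Liu2021.Def411WeilCarriers
open Literature.NumberTheory.Automorphic.Liu2021.Def411WeilCarriersDoubling
open Literature.NumberTheory.Automorphic.Liu2021.LemD1RankTwoCMLetters
open Literature.RepresentationTheory.MoeglinVignerasWaldspurger1987
open Summit.HodgeConjecture.HodgeConjecture.Cruxes.HLiu418.F0LD2LineThetaTypesComplementaryDefs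

namespace Summit.HodgeConjecture.HodgeConjecture.Cruxes.HLiu418.F0LD2LineComplementaryOfDisjoint

/-! ## §1 Generic `E/F`: complementary type sets of the two transported line carriers from disjointness -/

set_option maxHeartbeats 1600000 in -- as ★ `F0P2oU1DichotomyTransport` §3: six δ-model carriers + MVW's 30-argument instantiation
/-- **THE EXACT `(U(1), U(1))` DICHOTOMY AT THE TRANSPORTED LINE SECTIONS, FROM DISJOINTNESS (open-kernel currency).**  For a quadratic `E/F`, `c`,
a trace-zero `δ` (`δ² = d`), a hermitian line `J_V = T_V ⊗ 1`, a place `v` of `F` NON-SPLIT in `E`, two splitting families `𝓢₁, 𝓢₂` of the rank-(1,1)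
pairs `(J_V, (a₁))`, `(J_V, (a₂))` with `(d, a₂a₁⁻¹)_v = −1` (the two lines in different classes) and their `e′_a`-transported δ-model carriers
`ω_{s₁}, ω_{s₂}` on the compact torus `U(J_V)(F_v) = E_v¹`: if no open-kernel character `ξ` has BOTH `ω_{s₁}[ξ] ≠ 0` and `ω_{s₂}[ξ] ≠ 0`, then
`dim ω_{s₁}[ξ] + dim ω_{s₂}[ξ] = 1` for every open-kernel `ξ` — MVW's shifted dichotomy ★ `rankOne_theta_dichotomy` + the shift removal ★
`finrank_weightSpace_add_eq_one_of_shift_of_disjoint`. [cite: MoeglinVignerasWaldspurger1987, Chap. 3 §IV.4 Théorème principal]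
[cite: HarrisKudlaSweet1996, Cor. 4.4 p. 962] -/
theorem finrank_weightSpace_add_eq_one_of_disjoint_lines
    (F E : Type) [Field F] [NumberField F] [Field E] [NumberField E] [Algebra F E] [Algebra.IsQuadraticExtension F E]
    (c : E ≃ₐ[F] E) {δ : E} (hcδ : c δ = -δ) (hδ : δ ≠ 0) {d : F} (hd : δ * δ = algebraMap F E d)
    (TV : Matrix (Fin 1) (Fin 1) F) (hV : TV.IsSymm) (hVd : IsUnit TV.det) (JV : Matrix (Fin 1) (Fin 1) E)
    (hJV : JV = TV.map (algebraMap F E)) (v : HeightOneSpectrum (𝓞 F)) (hE : IsField (UnitaryGroup.LocalRing E v))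
    (a₁ a₂ : Fˣ)
    (𝓢₁ : FinLocalSplittings F E c 1 hcδ hδ hd (gram F (Equiv.prodUnique (Fin 1) (Fin 1)) TV (TW F a₁))
      (isSymm_gram F (Equiv.prodUnique (Fin 1) (Fin 1)) hV (isSymm_TW F a₁))
      (reindex_kronecker_eq_gram_map F E (Equiv.prodUnique (Fin 1) (Fin 1)) hJV (JW_eq F E a₁)))
    (𝓢₂ : FinLocalSplittings F E c 1 hcδ hδ hd (gram F (Equiv.prodUnique (Fin 1) (Fin 1)) TV (TW F a₂))
      (isSymm_gram F (Equiv.prodUnique (Fin 1) (Fin 1)) hV (isSymm_TW F a₂))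
      (reindex_kronecker_eq_gram_map F E (Equiv.prodUnique (Fin 1) (Fin 1)) hJV (JW_eq F E a₂)))
    (hcls : QuadraticForms.hilbertSymbol (v.adicCompletion F) ((d : F) : v.adicCompletion F)
      (((a₂ * a₁⁻¹ : Fˣ) : F) : v.adicCompletion F) = -1)
    (hdisj : ∀ ξ : localPi E c 1 JV v →* ℂˣ, IsOpen (ξ.ker : Set (localPi E c 1 JV v)) →
      Module.finrank ℂ (weightSpace ((MpPsi.toRep (localSchrodinger F 1 TV v)).comp
          (lineTransportSection F E c 1 hcδ hδ hd TV hV JV hJV a₁ v (𝓢₁.s v) (𝓢₁.proj_s v))) id (fun k => ((ξ k : ℂˣ) : ℂ))) = 0 ∨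
        Module.finrank ℂ (weightSpace ((MpPsi.toRep (localSchrodinger F 1 TV v)).comp
          (lineTransportSection F E c 1 hcδ hδ hd TV hV JV hJV a₂ v (𝓢₂.s v) (𝓢₂.proj_s v))) id (fun k => ((ξ k : ℂˣ) : ℂ))) = 0)
    (ξ : localPi E c 1 JV v →* ℂˣ) (hξ : IsOpen (ξ.ker : Set (localPi E c 1 JV v))) :
    Module.finrank ℂ (weightSpace ((MpPsi.toRep (localSchrodinger F 1 TV v)).comp
          (lineTransportSection F E c 1 hcδ hδ hd TV hV JV hJV a₁ v (𝓢₁.s v) (𝓢₁.proj_s v))) id (fun k => ((ξ k : ℂˣ) : ℂ))) +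
      Module.finrank ℂ (weightSpace ((MpPsi.toRep (localSchrodinger F 1 TV v)).comp
          (lineTransportSection F E c 1 hcδ hδ hd TV hV JV hJV a₂ v (𝓢₂.s v) (𝓢₂.proj_s v))) id (fun k => ((ξ k : ℂˣ) : ℂ))) = 1 := by
  classical
  haveI : CharZero (v.adicCompletion F) := charZero_of_injective_algebraMap (algebraMap F _).injective
  -- the torus `K = U(J_V)(F_v)` is compact
  haveI : CompactSpace (localPi E c 1 JV v) := compactSpace_localPi_rankOne F E c hcδ hδ hVd hJV v hE
  -- the class sign in MVW's currency: `(α, d₁)_v = -1` with `δ₁ = a₁⁻¹δ`, `δ₂ = a₂⁻¹δ = α δ₁`, `α = a₂⁻¹a₁`, `d₁ = a₁⁻²d` (★ F0P2o §3 verbatim)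
  have ha₁ : ((a₁ : F) : v.adicCompletion F) ≠ 0 := (map_ne_zero_iff _ (algebraMap F (v.adicCompletion F)).injective).2 a₁.ne_zero
  have ha₂ : ((a₂ : F) : v.adicCompletion F) ≠ 0 := (map_ne_zero_iff _ (algebraMap F (v.adicCompletion F)).injective).2 a₂.ne_zero
  have hα0 : ((a₂⁻¹ * a₁ : Fˣ) : F) ≠ 0 := (a₂⁻¹ * a₁).ne_zero
  have hα : algebraMap F E (↑a₂⁻¹ : F) * δ = algebraMap F E ((a₂⁻¹ * a₁ : Fˣ) : F) * (algebraMap F E (↑a₁⁻¹ : F) * δ) := by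
    rw [← mul_assoc, ← map_mul, Units.val_mul, mul_assoc, ← Units.val_mul, mul_inv_cancel, Units.val_one, mul_one]
  have hclass : QuadraticForms.hilbertSymbol (v.adicCompletion F) ((((a₂⁻¹ * a₁ : Fˣ) : F)) : v.adicCompletion F)
      (((↑a₁⁻¹ * ↑a₁⁻¹ * d : F)) : v.adicCompletion F) = -1 := by
    have hc2 : ((((a₂⁻¹ * a₁ : Fˣ) : F)) : v.adicCompletion F) ≠ 0 :=
      (map_ne_zero_iff _ (algebraMap F (v.adicCompletion F)).injective).2 hα0
    have e1 : (((↑a₁⁻¹ * ↑a₁⁻¹ * d : F)) : v.adicCompletion F) =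
        ((d : F) : v.adicCompletion F) * ((((a₁ : F) : v.adicCompletion F))⁻¹) ^ 2 := by
      change algebraMap F (v.adicCompletion F) (↑a₁⁻¹ * ↑a₁⁻¹ * d) =
        algebraMap F (v.adicCompletion F) d * (algebraMap F (v.adicCompletion F) (a₁ : F))⁻¹ ^ 2
      rw [map_mul, map_mul, Units.val_inv_eq_inv_val, map_inv₀]; ring
    have e2 : ((((a₂⁻¹ * a₁ : Fˣ) : F)) : v.adicCompletion F) =
        (((a₂ * a₁⁻¹ : Fˣ) : F) : v.adicCompletion F) * (((((a₂⁻¹ * a₁ : Fˣ) : F)) : v.adicCompletion F)) ^ 2 := by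
      change algebraMap F (v.adicCompletion F) ((a₂⁻¹ * a₁ : Fˣ) : F) =
        algebraMap F (v.adicCompletion F) ((a₂ * a₁⁻¹ : Fˣ) : F) * (algebraMap F (v.adicCompletion F) ((a₂⁻¹ * a₁ : Fˣ) : F)) ^ 2
      have ha₁' : algebraMap F (v.adicCompletion F) (a₁ : F) ≠ 0 := ha₁
      have ha₂' : algebraMap F (v.adicCompletion F) (a₂ : F) ≠ 0 := ha₂
      rw [Units.val_mul, Units.val_mul, Units.val_inv_eq_inv_val, Units.val_inv_eq_inv_val, map_mul, map_mul, map_inv₀, map_inv₀]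
      field_simp
    rw [e1, Weil1964.hilbertSymbol_mul_sq_right _ _ (inv_ne_zero ha₁), QuadraticForms.hilbertSymbol_comm, e2,
      Weil1964.hilbertSymbol_mul_sq_right _ _ hc2]
    exact hcls
  -- MVW's shifted dichotomy (Haar measure and conductor exponent of `ψ_v` supplied locally)
  obtain ⟨θ, hθo, hshift⟩ := by
    letI : MeasurableSpace (v.adicCompletion F) := borel _
    haveI : BorelSpace (v.adicCompletion F) := ⟨rfl⟩
    exact rankOne_theta_dichotomy F E c (algebraMap F E (↑a₁⁻¹ : F) * δ) (conj_lineDelta hcδ a₁)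
      (lineDelta_ne_zero hδ a₁) (↑a₁⁻¹ * ↑a₁⁻¹ * d) (lineDelta_mul_self hd a₁) (algebraMap F E (↑a₂⁻¹ : F) * δ) (conj_lineDelta hcδ a₂)
      (lineDelta_ne_zero hδ a₂) (↑a₂⁻¹ * ↑a₂⁻¹ * d) (lineDelta_mul_self hd a₂) ((a₂⁻¹ * a₁ : Fˣ) : F) hα0 hα TV hV hVd JV hJV v hE
      (lineTransportSection F E c 1 hcδ hδ hd TV hV JV hJV a₁ v (𝓢₁.s v) (𝓢₁.proj_s v)) (proj_lineTransportSection F E c 1 hcδ hδ hd TV hV JV hJV a₁ v (𝓢₁.s v) (𝓢₁.proj_s v))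
      (isSmooth_lineTransportSection F E c 1 hcδ hδ hd TV hV JV hJV a₁ v (𝓢₁.s v) (𝓢₁.proj_s v) (𝓢₁.smooth v))
      (lineTransportSection F E c 1 hcδ hδ hd TV hV JV hJV a₂ v (𝓢₂.s v) (𝓢₂.proj_s v)) (proj_lineTransportSection F E c 1 hcδ hδ hd TV hV JV hJV a₂ v (𝓢₂.s v) (𝓢₂.proj_s v))
      (isSmooth_lineTransportSection F E c 1 hcδ hδ hd TV hV JV hJV a₂ v (𝓢₂.s v) (𝓢₂.proj_s v) (𝓢₂.smooth v))
      (Measure.addHaar : Measure (v.adicCompletion F)) _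
        (isContinuousNontrivial_adeleAddCharAt F v).exists_hasConductorExp.choose_spec hclass
  -- the shift drops out under disjointness
  exact TwistedCoinv.finrank_weightSpace_add_eq_one_of_shift_of_disjoint _ _ θ hθo hshift hdisj ξ hξ

set_option maxHeartbeats 1600000 in -- as §1
/-- **The same with disjointness in COINVARIANT currency** (the language of B-p04's doubling relation ★ `LocalDoubledBlockTypesDuality`): if no open-kernel
`ξ` has both `Coinv_ξ(ω_{s₁}) ≠ 0` and `Coinv_ξ(ω_{s₂}) ≠ 0`, then `dim ω_{s₁}[ξ] + dim ω_{s₂}[ξ] = 1` for every open-kernel `ξ` — for the smooth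
carriers of the compact torus the `ξ`-coinvariants ARE the `ξ`-weight spaces (★ `exists_linearEquiv_weightSpace_coinv`), so this is §1.
[cite: MoeglinVignerasWaldspurger1987, Chap. 3 §IV.4 Théorème principal] [cite: BernsteinZelevinsky1976, §2.3] -/
theorem finrank_weightSpace_add_eq_one_of_coinv_disjoint_lines
    (F E : Type) [Field F] [NumberField F] [Field E] [NumberField E] [Algebra F E] [Algebra.IsQuadraticExtension F E]
    (c : E ≃ₐ[F] E) {δ : E} (hcδ : c δ = -δ) (hδ : δ ≠ 0) {d : F} (hd : δ * δ = algebraMap F E d)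
    (TV : Matrix (Fin 1) (Fin 1) F) (hV : TV.IsSymm) (hVd : IsUnit TV.det) (JV : Matrix (Fin 1) (Fin 1) E)
    (hJV : JV = TV.map (algebraMap F E)) (v : HeightOneSpectrum (𝓞 F)) (hE : IsField (UnitaryGroup.LocalRing E v))
    (a₁ a₂ : Fˣ)
    (𝓢₁ : FinLocalSplittings F E c 1 hcδ hδ hd (gram F (Equiv.prodUnique (Fin 1) (Fin 1)) TV (TW F a₁))
      (isSymm_gram F (Equiv.prodUnique (Fin 1) (Fin 1)) hV (isSymm_TW F a₁))
      (reindex_kronecker_eq_gram_map F E (Equiv.prodUnique (Fin 1) (Fin 1)) hJV (JW_eq F E a₁)))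
    (𝓢₂ : FinLocalSplittings F E c 1 hcδ hδ hd (gram F (Equiv.prodUnique (Fin 1) (Fin 1)) TV (TW F a₂))
      (isSymm_gram F (Equiv.prodUnique (Fin 1) (Fin 1)) hV (isSymm_TW F a₂))
      (reindex_kronecker_eq_gram_map F E (Equiv.prodUnique (Fin 1) (Fin 1)) hJV (JW_eq F E a₂)))
    (hcls : QuadraticForms.hilbertSymbol (v.adicCompletion F) ((d : F) : v.adicCompletion F)
      (((a₂ * a₁⁻¹ : Fˣ) : F) : v.adicCompletion F) = -1)
    (hdisj : ∀ ξ : localPi E c 1 JV v →* ℂˣ, IsOpen (ξ.ker : Set (localPi E c 1 JV v)) →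
      Nontrivial (TwistedCoinv.Coinv ((MpPsi.toRep (localSchrodinger F 1 TV v)).comp
          (lineTransportSection F E c 1 hcδ hδ hd TV hV JV hJV a₁ v (𝓢₁.s v) (𝓢₁.proj_s v))) ξ) →
        Nontrivial (TwistedCoinv.Coinv ((MpPsi.toRep (localSchrodinger F 1 TV v)).comp
          (lineTransportSection F E c 1 hcδ hδ hd TV hV JV hJV a₂ v (𝓢₂.s v) (𝓢₂.proj_s v))) ξ) → False)
    (ξ : localPi E c 1 JV v →* ℂˣ) (hξ : IsOpen (ξ.ker : Set (localPi E c 1 JV v))) :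
    Module.finrank ℂ (weightSpace ((MpPsi.toRep (localSchrodinger F 1 TV v)).comp
          (lineTransportSection F E c 1 hcδ hδ hd TV hV JV hJV a₁ v (𝓢₁.s v) (𝓢₁.proj_s v))) id (fun k => ((ξ k : ℂˣ) : ℂ))) +
      Module.finrank ℂ (weightSpace ((MpPsi.toRep (localSchrodinger F 1 TV v)).comp
          (lineTransportSection F E c 1 hcδ hδ hd TV hV JV hJV a₂ v (𝓢₂.s v) (𝓢₂.proj_s v))) id (fun k => ((ξ k : ℂˣ) : ℂ))) = 1 := by
  haveI : CompactSpace (localPi E c 1 JV v) := compactSpace_localPi_rankOne F E c hcδ hδ hVd hJV v hE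
  refine finrank_weightSpace_add_eq_one_of_disjoint_lines F E c hcδ hδ hd TV hV hVd JV hJV v hE a₁ a₂ 𝓢₁ 𝓢₂ hcls (fun χ hχ => ?_) ξ hξ
  -- coinvariants = weight spaces (smooth carriers, open kernel): two non-zero weight spaces would give two non-zero coinvariant spaces
  by_contra hne
  have hne₁ := fun h0 => hne (Or.inl h0)
  have hne₂ := fun h0 => hne (Or.inr h0)
  obtain ⟨e₁, -⟩ := exists_linearEquiv_weightSpace_coinv ((MpPsi.toRep (localSchrodinger F 1 TV v)).comp
          (lineTransportSection F E c 1 hcδ hδ hd TV hV JV hJV a₁ v (𝓢₁.s v) (𝓢₁.proj_s v))) χ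
    (isSmooth_lineTransportSection F E c 1 hcδ hδ hd TV hV JV hJV a₁ v (𝓢₁.s v) (𝓢₁.proj_s v) (𝓢₁.smooth v)) hχ
  obtain ⟨e₂, -⟩ := exists_linearEquiv_weightSpace_coinv ((MpPsi.toRep (localSchrodinger F 1 TV v)).comp
          (lineTransportSection F E c 1 hcδ hδ hd TV hV JV hJV a₂ v (𝓢₂.s v) (𝓢₂.proj_s v))) χ
    (isSmooth_lineTransportSection F E c 1 hcδ hδ hd TV hV JV hJV a₂ v (𝓢₂.s v) (𝓢₂.proj_s v) (𝓢₂.smooth v)) hχ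
  haveI := Module.nontrivial_of_finrank_pos (R := ℂ) (Nat.pos_of_ne_zero hne₁)
  haveI := Module.nontrivial_of_finrank_pos (R := ℂ) (Nat.pos_of_ne_zero hne₂)
  exact hdisj χ hχ e₁.injective.nontrivial e₂.injective.nontrivial

/-! ## §2 The letter's guard is the class sign -/

/-- **the GUARD says `a⁻¹a′` is not a norm from `E_v`**: with Step-1 representatives `ε(xδ) = x⁻¹δ ⊗ 1 ∈ E_vˣ` (★ `LemD1OfPlace.eps` at
`lineDelta`), «`ε(aδ) ≠ x·x̄·ε(a′δ)` for every `x ∈ E_vˣ`» implies «`a⁻¹a′ ≠ z·z̄` for every `z ∈ E_vˣ`» (indeed `ε(aδ) = (a⁻¹a′)·ε(a′δ)`).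
[cite: Liu2021, App. D §D.1 Step 1 (l. 5217)] -/
theorem not_isNorm_of_eps_guard
    (F E : Type) [Field F] [NumberField F] [Field E] [NumberField E] [Algebra F E]
    (c : E ≃ₐ[F] E) {δ : E} (hδ : δ ≠ 0) (v : HeightOneSpectrum (𝓞 F)) (a a' : Fˣ)
    (hg : ¬ ∃ x : (UnitaryGroup.LocalRing E v)ˣ, LemD1OfPlace.eps E v (lineDelta_ne_zero hδ a) =
        x * Units.map (conjLocal E c v : UnitaryGroup.LocalRing E v →* UnitaryGroup.LocalRing E v) x *
          LemD1OfPlace.eps E v (lineDelta_ne_zero hδ a')) :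
    ¬ ∃ z : (UnitaryGroup.LocalRing E v)ˣ, (z : UnitaryGroup.LocalRing E v) * conjLocal E c v z =
      algebraMap E (UnitaryGroup.LocalRing E v) (algebraMap F E ((a⁻¹ * a' : Fˣ) : F)) := by
  rintro ⟨z, hz⟩
  refine hg ⟨z, Units.ext ?_⟩
  simp only [LemD1OfPlace.eps, Units.val_mul, Units.coe_map, RingHom.toMonoidHom_eq_coe, MonoidHom.coe_coe, Units.val_mk0]
  rw [hz, ← map_mul, ← mul_assoc, ← map_mul, ← Units.val_mul, mul_inv_cancel_right]

/-! ## §3 The CM heads: the organ's body at `v`, and the organ, from disjointness -/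

set_option synthInstance.maxHeartbeats 400000 in
set_option maxHeartbeats 4000000 in -- the CM θ-package section terms (as ★ `F0LD2LineThetaTypesComplementaryDefs`, 4 M)
/-- **THE ORGAN'S BODY AT `v` FROM DISJOINTNESS AT `v`** (CM tokens of ★ `LineThetaTypesComplementary₁`, verbatim): for a CM field `L`, a real non-zero
rank-one frame `dV₁`, a conjugate-symplectic `λ`, lines `a, a′` and a finite place `v` of `L⁺` NON-SPLIT in `L` at which the Step-1 representatives
`ε(aδ)`, `ε(a′δ)` are in different norm classes: IF for every open-kernel character `ξ` of `U(diag dV₁)(L⁺_v)` at most one of `ω_{s_{a′}}[ξ]`, `ω_{s_a}[ξ]` is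
non-zero (`finrank = 0 ∨ finrank = 0`), THEN `dim ω_{s_{a′}}[ξ] + dim ω_{s_a}[ξ] = 1` for every open-kernel `ξ` — §1 at the two `λ`-normalised Kudla
line families (★ `undoubledSplittings`), `L_v` a field by ★ `isField_localRing_cm_of_forall_smul_eq`, class sign by §2 + ★
`hilbertSymbol_eq_neg_one_of_not_isNorm`. [cite: MoeglinVignerasWaldspurger1987, Chap. 3 §IV.4 Théorème principal] [cite: HarrisKudlaSweet1996, Cor. 4.4 p. 962]
[cite: Liu2021, App. D Lemma D.1 (4) (p. 126)] -/
theorem finrank_add_eq_one_of_disjoint_cm (L : Type) [Field L] [NumberField L] [IsCMField L]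
    (dV₁ : Fin 1 → L) (hdV₁ : ∀ i, IsCMField.complexConj L (dV₁ i) = dV₁ i) (hdV0₁ : ∀ i, dV₁ i ≠ 0)
    (lam : Literature.NumberTheory.Automorphic.IdeleClassGroup L →ₜ* Circle) (hlam : IsConjugateSymplectic L lam)
    (a a' : (↥(maximalRealSubfield L))ˣ) (v : HeightOneSpectrum (𝓞 ↥(maximalRealSubfield L)))
    (hns : ∀ w : UnitaryGroup.PlacesOver L v, IsCMField.complexConj L • (w : HeightOneSpectrum (𝓞 L)) = w)
    (hg : ¬ ∃ x : (LocalRing L v)ˣ, LemD1OfPlace.eps L v (lineDelta_ne_zero (imagUnit_ne_zero L) a) =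
        x * Units.map (conjLocal L (IsCMField.complexConj L) v : LocalRing L v →* LocalRing L v) x *
          LemD1OfPlace.eps L v (lineDelta_ne_zero (imagUnit_ne_zero L) a'))
    (hdisj : ∀ ξ : (localPi L (IsCMField.complexConj L) 1 (Matrix.diagonal dV₁) v) →* ℂˣ,
      IsOpen (ξ.ker : Set (localPi L (IsCMField.complexConj L) 1 (Matrix.diagonal dV₁) v)) →
      Module.finrank ℂ (weightSpace ((MpPsi.toRep (localSchrodinger (Fp L) 1 (realDiagonal L dV₁ hdV₁) v)).comp
          (lineTransportSection (Fp L) L (IsCMField.complexConj L) 1 (complexConj_imagUnit L) (imagUnit_ne_zero L) (imagUnit_mul_self L) (realDiagonal L dV₁ hdV₁) (realDiagonal_isSymm L dV₁ hdV₁) (Matrix.diagonal dV₁) (realDiagonal_map L dV₁ hdV₁).symm a' v ((congrW L (Equiv.prodUnique (Fin 1) (Fin 1)) dV₁ hdV₁ (lineW L (TW (Fp L) a')) (complexConj_lineW L (TW (Fp L) a')) (realDiagonal_lineW L (TW (Fp L) a')) (diagonal_lineW L (TW (Fp L) a') (JW_eq (Fp L) L a')) (undoubledSplittings L (Equiv.prodUnique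 (Fin 1) (Fin 1)) dV₁ hdV₁ hdV0₁ (lineW L (TW (Fp L) a')) (complexConj_lineW L (TW (Fp L) a')) (lineW_ne_zero L (TW (Fp L) a') (isUnit_det_TW (Fp L) a')) (toHeckeCharacter L lam) (borelPlaceMeasure L) (cmFinLocalFamily L (Equiv.prodUnique (Fin 1) (Fin 1)) dV₁ hdV₁ hdV0₁ (lineW L (TW (Fp L) a')) (complexConj_lineW L (TW (Fp L) a')) (lineW_ne_zero L (TW (Fp L) a') (isUnit_det_TW (Fp L) a')) (toHeckeCharacter L lam) ((isOscillatorChar_toHeckeCharacter_iff lam).mpr hlam) (borelPlaceMeasure L))) (isSymm_TW (Fp L) a') (JW_eq (Fp L) L a')).s v) ((congrW L (Equiv.prodUnique (Fin 1) (Fin 1)) dV₁ hdV₁ (lineW L (TW (Fp L) a')) (complexConj_lineW L (TW (Fp L) a')) (realDiagonal_lineW L (TW (Fp L) a')) (diagonal_lineW L (TW (Fp L) a') (JW_eq (Fp L) L a')) (undoubledSplittings L (Equiv.prodUnique (Fin 1) (Fin 1)) dV₁ hdV₁ hdV0₁ (lineW L (TW (Fp L) a')) (complexConj_lineW L (TW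 (Fp L) a')) (lineW_ne_zero L (TW (Fp L) a') (isUnit_det_TW (Fp L) a')) (toHeckeCharacter L lam) (borelPlaceMeasure L) (cmFinLocalFamily L (Equiv.prodUnique (Fin 1) (Fin 1)) dV₁ hdV₁ hdV0₁ (lineW L (TW (Fp L) a')) (complexConj_lineW L (TW (Fp L) a')) (lineW_ne_zero L (TW (Fp L) a') (isUnit_det_TW (Fp L) a')) (toHeckeCharacter L lam) ((isOscillatorChar_toHeckeCharacter_iff lam).mpr hlam) (borelPlaceMeasure L))) (isSymm_TW (Fp L) a') (JW_eq (Fp L) L a')).proj_s v))) id (fun k => ((ξ k : ℂˣ) : ℂ))) = 0 ∨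
        Module.finrank ℂ (weightSpace ((MpPsi.toRep (localSchrodinger (Fp L) 1 (realDiagonal L dV₁ hdV₁) v)).comp
          (lineTransportSection (Fp L) L (IsCMField.complexConj L) 1 (complexConj_imagUnit L) (imagUnit_ne_zero L) (imagUnit_mul_self L) (realDiagonal L dV₁ hdV₁) (realDiagonal_isSymm L dV₁ hdV₁) (Matrix.diagonal dV₁) (realDiagonal_map L dV₁ hdV₁).symm a v ((congrW L (Equiv.prodUnique (Fin 1) (Fin 1)) dV₁ hdV₁ (lineW L (TW (Fp L) a)) (complexConj_lineW L (TW (Fp L) a)) (realDiagonal_lineW L (TW (Fp L) a)) (diagonal_lineW L (TW (Fp L) a) (JW_eq (Fp L) L a)) (undoubledSplittings L (Equiv.prodUnique (Fin 1) (Fin 1)) dV₁ hdV₁ hdV0₁ (lineW L (TW (Fp L) a)) (complexConj_lineW L (TW (Fp L) a)) (lineW_ne_zero L (TW (Fp L) a) (isUnit_det_TW (Fp L) a)) (toHeckeCharacter L lam) (borelPlaceMeasure L) (cmFinLocalFamily L (Equiv.prodUnique (Fin 1) (Fin 1)) dV₁ hdV₁ hdV0₁ (lineW L (TW (Fp L)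 a)) (complexConj_lineW L (TW (Fp L) a)) (lineW_ne_zero L (TW (Fp L) a) (isUnit_det_TW (Fp L) a)) (toHeckeCharacter L lam) ((isOscillatorChar_toHeckeCharacter_iff lam).mpr hlam) (borelPlaceMeasure L))) (isSymm_TW (Fp L) a) (JW_eq (Fp L) L a)).s v) ((congrW L (Equiv.prodUnique (Fin 1) (Fin 1)) dV₁ hdV₁ (lineW L (TW (Fp L) a)) (complexConj_lineW L (TW (Fp L) a)) (realDiagonal_lineW L (TW (Fp L) a)) (diagonal_lineW L (TW (Fp L) a) (JW_eq (Fp L) L a)) (undoubledSplittings L (Equiv.prodUnique (Fin 1) (Fin 1)) dV₁ hdV₁ hdV0₁ (lineW L (TW (Fp L) a)) (complexConj_lineW L (TW (Fp L) a)) (lineW_ne_zero L (TW (Fp L) a) (isUnit_det_TW (Fp L) a)) (toHeckeCharacter L lam) (borelPlaceMeasure L) (cmFinLocalFamily L (Equiv.prodUnique (Fin 1) (Fin 1)) dV₁ hdV₁ hdV0₁ (lineW L (TW (Fp L) a)) (complexConj_lineW L (TW (Fp L) a)) (lineW_ne_zero L (TW (Fp L) a) (isUnit_det_TW (Fp L)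 a)) (toHeckeCharacter L lam) ((isOscillatorChar_toHeckeCharacter_iff lam).mpr hlam) (borelPlaceMeasure L))) (isSymm_TW (Fp L) a) (JW_eq (Fp L) L a)).proj_s v))) id (fun k => ((ξ k : ℂˣ) : ℂ))) = 0)
    (ξ : (localPi L (IsCMField.complexConj L) 1 (Matrix.diagonal dV₁) v) →* ℂˣ)
    (hξ : IsOpen (ξ.ker : Set (localPi L (IsCMField.complexConj L) 1 (Matrix.diagonal dV₁) v))) :
    Module.finrank ℂ (weightSpace ((MpPsi.toRep (localSchrodinger (Fp L) 1 (realDiagonal L dV₁ hdV₁) v)).comp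
          (lineTransportSection (Fp L) L (IsCMField.complexConj L) 1 (complexConj_imagUnit L) (imagUnit_ne_zero L) (imagUnit_mul_self L) (realDiagonal L dV₁ hdV₁) (realDiagonal_isSymm L dV₁ hdV₁) (Matrix.diagonal dV₁) (realDiagonal_map L dV₁ hdV₁).symm a' v ((congrW L (Equiv.prodUnique (Fin 1) (Fin 1)) dV₁ hdV₁ (lineW L (TW (Fp L) a')) (complexConj_lineW L (TW (Fp L) a')) (realDiagonal_lineW L (TW (Fp L) a')) (diagonal_lineW L (TW (Fp L) a') (JW_eq (Fp L) L a')) (undoubledSplittings L (Equiv.prodUnique (Fin 1) (Fin 1)) dV₁ hdV₁ hdV0₁ (lineW L (TW (Fp L) a')) (complexConj_lineW L (TW (Fp L) a')) (lineW_ne_zero L (TW (Fp L) a') (isUnit_det_TW (Fp L) a')) (toHeckeCharacter L lam) (borelPlaceMeasure L) (cmFinLocalFamily L (Equiv.prodUnique (Fin 1) (Fin 1)) dV₁ hdV₁ hdV0₁ (lineW L (TW (Fp L) a')) (complexConj_lineW L (TW (Fp L) a')) (lineW_ne_zero L (TW (Fp L) a') (isUnit_det_TW (Fp L) a')) (toHeckeCharacter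 L lam) ((isOscillatorChar_toHeckeCharacter_iff lam).mpr hlam) (borelPlaceMeasure L))) (isSymm_TW (Fp L) a') (JW_eq (Fp L) L a')).s v) ((congrW L (Equiv.prodUnique (Fin 1) (Fin 1)) dV₁ hdV₁ (lineW L (TW (Fp L) a')) (complexConj_lineW L (TW (Fp L) a')) (realDiagonal_lineW L (TW (Fp L) a')) (diagonal_lineW L (TW (Fp L) a') (JW_eq (Fp L) L a')) (undoubledSplittings L (Equiv.prodUnique (Fin 1) (Fin 1)) dV₁ hdV₁ hdV0₁ (lineW L (TW (Fp L) a')) (complexConj_lineW L (TW (Fp L) a')) (lineW_ne_zero L (TW (Fp L) a') (isUnit_det_TW (Fp L) a')) (toHeckeCharacter L lam) (borelPlaceMeasure L) (cmFinLocalFamily L (Equiv.prodUnique (Fin 1) (Fin 1)) dV₁ hdV₁ hdV0₁ (lineW L (TW (Fp L) a')) (complexConj_lineW L (TW (Fp L) a')) (lineW_ne_zero L (TW (Fp L) a') (isUnit_det_TW (Fp L) a')) (toHeckeCharacter L lam) ((isOscillatorChar_toHeckeCharacter_iff lam).mpr hlam) (borelPlaceMeasure L))) (isSymm_TW (Fp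 L) a') (JW_eq (Fp L) L a')).proj_s v))) id (fun k => ((ξ k : ℂˣ) : ℂ))) +
      Module.finrank ℂ (weightSpace ((MpPsi.toRep (localSchrodinger (Fp L) 1 (realDiagonal L dV₁ hdV₁) v)).comp
          (lineTransportSection (Fp L) L (IsCMField.complexConj L) 1 (complexConj_imagUnit L) (imagUnit_ne_zero L) (imagUnit_mul_self L) (realDiagonal L dV₁ hdV₁) (realDiagonal_isSymm L dV₁ hdV₁) (Matrix.diagonal dV₁) (realDiagonal_map L dV₁ hdV₁).symm a v ((congrW L (Equiv.prodUnique (Fin 1) (Fin 1)) dV₁ hdV₁ (lineW L (TW (Fp L) a)) (complexConj_lineW L (TW (Fp L) a)) (realDiagonal_lineW L (TW (Fp L) a)) (diagonal_lineW L (TW (Fp L) a) (JW_eq (Fp L) L a)) (undoubledSplittings L (Equiv.prodUnique (Fin 1) (Fin 1)) dV₁ hdV₁ hdV0₁ (lineW L (TW (Fp L) a)) (complexConj_lineW L (TW (Fp L) a)) (lineW_ne_zero L (TW (Fp L) a) (isUnit_det_TW (Fp L) a)) (toHeckeCharacter L lam) (borelPlaceMeasure L) (cmFinLocalFamily L (Equiv.prodUnique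 (Fin 1) (Fin 1)) dV₁ hdV₁ hdV0₁ (lineW L (TW (Fp L) a)) (complexConj_lineW L (TW (Fp L) a)) (lineW_ne_zero L (TW (Fp L) a) (isUnit_det_TW (Fp L) a)) (toHeckeCharacter L lam) ((isOscillatorChar_toHeckeCharacter_iff lam).mpr hlam) (borelPlaceMeasure L))) (isSymm_TW (Fp L) a) (JW_eq (Fp L) L a)).s v) ((congrW L (Equiv.prodUnique (Fin 1) (Fin 1)) dV₁ hdV₁ (lineW L (TW (Fp L) a)) (complexConj_lineW L (TW (Fp L) a)) (realDiagonal_lineW L (TW (Fp L) a)) (diagonal_lineW L (TW (Fp L) a) (JW_eq (Fp L) L a)) (undoubledSplittings L (Equiv.prodUnique (Fin 1) (Fin 1)) dV₁ hdV₁ hdV0₁ (lineW L (TW (Fp L) a)) (complexConj_lineW L (TW (Fp L) a)) (lineW_ne_zero L (TW (Fp L) a) (isUnit_det_TW (Fp L) a)) (toHeckeCharacter L lam) (borelPlaceMeasure L) (cmFinLocalFamily L (Equiv.prodUnique (Fin 1) (Fin 1)) dV₁ hdV₁ hdV0₁ (lineW L (TW (Fp L) a)) (complexConj_lineW L (TW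 (Fp L) a)) (lineW_ne_zero L (TW (Fp L) a) (isUnit_det_TW (Fp L) a)) (toHeckeCharacter L lam) ((isOscillatorChar_toHeckeCharacter_iff lam).mpr hlam) (borelPlaceMeasure L))) (isSymm_TW (Fp L) a) (JW_eq (Fp L) L a)).proj_s v))) id (fun k => ((ξ k : ℂˣ) : ℂ))) = 1 := by
  have hE : IsField (UnitaryGroup.LocalRing L v) := isField_localRing_cm_of_forall_smul_eq L v hns
  -- the class sign `(d, a′a⁻¹)_v = -1` from the guard
  have hN := not_isNorm_of_eps_guard (Fp L) L (IsCMField.complexConj L) (imagUnit_ne_zero L) v a a' hg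
  have hcls := _root_.Summit.HodgeConjecture.HodgeConjecture.Cruxes.H413.F0P2oU1DichotomyTransport.hilbertSymbol_eq_neg_one_of_not_isNorm
    (Fp L) L (IsCMField.complexConj L)
    (complexConj_imagUnit L) (imagUnit_ne_zero L) (imagUnit_mul_self L) v hE (a⁻¹ * a').ne_zero hN
  rw [show (a⁻¹ * a' : (Fp L)ˣ) = a' * a⁻¹ from mul_comm _ _] at hcls
  -- §1 with `(a₁, a₂) := (a, a′)`, then swap the summands
  have key := finrank_weightSpace_add_eq_one_of_disjoint_lines (Fp L) L (IsCMField.complexConj L) (complexConj_imagUnit L) (imagUnit_ne_zero L)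
    (imagUnit_mul_self L) (realDiagonal L dV₁ hdV₁) (realDiagonal_isSymm L dV₁ hdV₁) (isUnit_det_realDiagonal L dV₁ hdV₁ hdV0₁) (Matrix.diagonal dV₁)
    (realDiagonal_map L dV₁ hdV₁).symm v hE a a'
    (congrW L (Equiv.prodUnique (Fin 1) (Fin 1)) dV₁ hdV₁ (lineW L (TW (Fp L) a)) (complexConj_lineW L (TW (Fp L) a)) (realDiagonal_lineW L (TW (Fp L) a)) (diagonal_lineW L (TW (Fp L) a) (JW_eq (Fp L) L a)) (undoubledSplittings L (Equiv.prodUnique (Fin 1) (Fin 1)) dV₁ hdV₁ hdV0₁ (lineW L (TW (Fp L) a)) (complexConj_lineW L (TW (Fp L) a)) (lineW_ne_zero L (TW (Fp L) a) (isUnit_det_TW (Fp L) a)) (toHeckeCharacter L lam) (borelPlaceMeasure L) (cmFinLocalFamily L (Equiv.prodUnique (Fin 1) (Fin 1)) dV₁ hdV₁ hdV0₁ (lineW L (TW (Fp L) a)) (complexConj_lineW L (TW (Fp L) a)) (lineW_ne_zero L (TW (Fp L) a) (isUnit_det_TW (Fp L) a)) (toHeckeCharacter L lam) ((isOscillatorChar_toHeckeCharacter_iff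 lam).mpr hlam) (borelPlaceMeasure L))) (isSymm_TW (Fp L) a) (JW_eq (Fp L) L a))
    (congrW L (Equiv.prodUnique (Fin 1) (Fin 1)) dV₁ hdV₁ (lineW L (TW (Fp L) a')) (complexConj_lineW L (TW (Fp L) a')) (realDiagonal_lineW L (TW (Fp L) a')) (diagonal_lineW L (TW (Fp L) a') (JW_eq (Fp L) L a')) (undoubledSplittings L (Equiv.prodUnique (Fin 1) (Fin 1)) dV₁ hdV₁ hdV0₁ (lineW L (TW (Fp L) a')) (complexConj_lineW L (TW (Fp L) a')) (lineW_ne_zero L (TW (Fp L) a') (isUnit_det_TW (Fp L) a')) (toHeckeCharacter L lam) (borelPlaceMeasure L) (cmFinLocalFamily L (Equiv.prodUnique (Fin 1) (Fin 1)) dV₁ hdV₁ hdV0₁ (lineW L (TW (Fp L) a')) (complexConj_lineW L (TW (Fp L) a')) (lineW_ne_zero L (TW (Fp L) a') (isUnit_det_TW (Fp L) a')) (toHeckeCharacter L lam) ((isOscillatorChar_toHeckeCharacter_iff lam).mpr hlam) (borelPlaceMeasure L))) (isSymm_TW (Fp L) a') (JW_eq (Fp L) L a'))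
    hcls (fun χ hχ => (hdisj χ hχ).symm) ξ hξ
  omega

set_option synthInstance.maxHeartbeats 400000 in
set_option maxHeartbeats 4000000 in -- the CM θ-package section terms (as ★ `F0LD2LineThetaTypesComplementaryDefs`, 4 M)
/-- **THE ORGAN FROM DISJOINTNESS**: if at every non-split guarded place the two same-`λ` rank-one line representations have DISJOINT type sets (the organ's
statement with «`finrank = 0 ∨ finrank = 0`» in place of «`finrank + finrank = 1`», spelled out on the organ's tokens), then ★ `LineThetaTypesComplementary₁`
holds — the in-house price of the LD2∕LD1 organ is exactly disjointness. [cite: MoeglinVignerasWaldspurger1987, Chap. 3 §IV.4 Théorème principal]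
[cite: HarrisKudlaSweet1996, Cor. 4.4 p. 962] [cite: Liu2021, App. D Lemma D.1 (4) (p. 126)] -/
theorem lineThetaTypesComplementary₁_of_disjoint
    (h : ∀ (L : Type) [Field L] [NumberField L] [IsCMField L]
    (dV₁ : Fin 1 → L) (hdV₁ : ∀ i, IsCMField.complexConj L (dV₁ i) = dV₁ i) (hdV0₁ : ∀ i, dV₁ i ≠ 0)
    (lam : Literature.NumberTheory.Automorphic.IdeleClassGroup L →ₜ* Circle) (hlam : IsConjugateSymplectic L lam)
    (a a' : (↥(maximalRealSubfield L))ˣ) (v : HeightOneSpectrum (𝓞 ↥(maximalRealSubfield L))),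
    (∀ w : UnitaryGroup.PlacesOver L v, IsCMField.complexConj L • (w : HeightOneSpectrum (𝓞 L)) = w) →
    (¬ ∃ x : (LocalRing L v)ˣ, LemD1OfPlace.eps L v (lineDelta_ne_zero (imagUnit_ne_zero L) a) =
        x * Units.map (conjLocal L (IsCMField.complexConj L) v : LocalRing L v →* LocalRing L v) x *
          LemD1OfPlace.eps L v (lineDelta_ne_zero (imagUnit_ne_zero L) a')) →
    ∀ ξ : (localPi L (IsCMField.complexConj L) 1 (Matrix.diagonal dV₁) v) →* ℂˣ,
      IsOpen (ξ.ker : Set (localPi L (IsCMField.complexConj L) 1 (Matrix.diagonal dV₁) v)) →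
      Module.finrank ℂ (weightSpace ((MpPsi.toRep (localSchrodinger (Fp L) 1 (realDiagonal L dV₁ hdV₁) v)).comp
          (lineTransportSection (Fp L) L (IsCMField.complexConj L) 1 (complexConj_imagUnit L) (imagUnit_ne_zero L) (imagUnit_mul_self L) (realDiagonal L dV₁ hdV₁) (realDiagonal_isSymm L dV₁ hdV₁) (Matrix.diagonal dV₁) (realDiagonal_map L dV₁ hdV₁).symm a' v ((congrW L (Equiv.prodUnique (Fin 1) (Fin 1)) dV₁ hdV₁ (lineW L (TW (Fp L) a')) (complexConj_lineW L (TW (Fp L) a')) (realDiagonal_lineW L (TW (Fp L) a')) (diagonal_lineW L (TW (Fp L) a') (JW_eq (Fp L) L a')) (undoubledSplittings L (Equiv.prodUnique (Fin 1) (Fin 1)) dV₁ hdV₁ hdV0₁ (lineW L (TW (Fp L) a')) (complexConj_lineW L (TW (Fp L) a')) (lineW_ne_zero L (TW (Fp L) a') (isUnit_det_TW (Fp L) a')) (toHeckeCharacter L lam) (borelPlaceMeasure L) (cmFinLocalFamily L (Equiv.prodUnique (Fin 1) (Fin 1)) dV₁ hdV₁ hdV0₁ (lineW L (TW (Fp L)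 a')) (complexConj_lineW L (TW (Fp L) a')) (lineW_ne_zero L (TW (Fp L) a') (isUnit_det_TW (Fp L) a')) (toHeckeCharacter L lam) ((isOscillatorChar_toHeckeCharacter_iff lam).mpr hlam) (borelPlaceMeasure L))) (isSymm_TW (Fp L) a') (JW_eq (Fp L) L a')).s v) ((congrW L (Equiv.prodUnique (Fin 1) (Fin 1)) dV₁ hdV₁ (lineW L (TW (Fp L) a')) (complexConj_lineW L (TW (Fp L) a')) (realDiagonal_lineW L (TW (Fp L) a')) (diagonal_lineW L (TW (Fp L) a') (JW_eq (Fp L) L a')) (undoubledSplittings L (Equiv.prodUnique (Fin 1) (Fin 1)) dV₁ hdV₁ hdV0₁ (lineW L (TW (Fp L) a')) (complexConj_lineW L (TW (Fp L) a')) (lineW_ne_zero L (TW (Fp L) a') (isUnit_det_TW (Fp L) a')) (toHeckeCharacter L lam) (borelPlaceMeasure L) (cmFinLocalFamily L (Equiv.prodUnique (Fin 1) (Fin 1)) dV₁ hdV₁ hdV0₁ (lineW L (TW (Fp L) a')) (complexConj_lineW L (TW (Fp L) a')) (lineW_ne_zero L (TW (Fp L) a') (isUnit_det_TW (Fp L)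 a')) (toHeckeCharacter L lam) ((isOscillatorChar_toHeckeCharacter_iff lam).mpr hlam) (borelPlaceMeasure L))) (isSymm_TW (Fp L) a') (JW_eq (Fp L) L a')).proj_s v))) id (fun k => ((ξ k : ℂˣ) : ℂ))) = 0 ∨
        Module.finrank ℂ (weightSpace ((MpPsi.toRep (localSchrodinger (Fp L) 1 (realDiagonal L dV₁ hdV₁) v)).comp
          (lineTransportSection (Fp L) L (IsCMField.complexConj L) 1 (complexConj_imagUnit L) (imagUnit_ne_zero L) (imagUnit_mul_self L) (realDiagonal L dV₁ hdV₁) (realDiagonal_isSymm L dV₁ hdV₁) (Matrix.diagonal dV₁) (realDiagonal_map L dV₁ hdV₁).symm a v ((congrW L (Equiv.prodUnique (Fin 1) (Fin 1)) dV₁ hdV₁ (lineW L (TW (Fp L) a)) (complexConj_lineW L (TW (Fp L) a)) (realDiagonal_lineW L (TW (Fp L) a)) (diagonal_lineW L (TW (Fp L) a) (JW_eq (Fp L) L a)) (undoubledSplittings L (Equiv.prodUnique (Fin 1) (Fin 1)) dV₁ hdV₁ hdV0₁ (lineW L (TW (Fp L) a)) (complexConj_lineW L (TW (Fp L) a)) (lineW_ne_zero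 L (TW (Fp L) a) (isUnit_det_TW (Fp L) a)) (toHeckeCharacter L lam) (borelPlaceMeasure L) (cmFinLocalFamily L (Equiv.prodUnique (Fin 1) (Fin 1)) dV₁ hdV₁ hdV0₁ (lineW L (TW (Fp L) a)) (complexConj_lineW L (TW (Fp L) a)) (lineW_ne_zero L (TW (Fp L) a) (isUnit_det_TW (Fp L) a)) (toHeckeCharacter L lam) ((isOscillatorChar_toHeckeCharacter_iff lam).mpr hlam) (borelPlaceMeasure L))) (isSymm_TW (Fp L) a) (JW_eq (Fp L) L a)).s v) ((congrW L (Equiv.prodUnique (Fin 1) (Fin 1)) dV₁ hdV₁ (lineW L (TW (Fp L) a)) (complexConj_lineW L (TW (Fp L) a)) (realDiagonal_lineW L (TW (Fp L) a)) (diagonal_lineW L (TW (Fp L) a) (JW_eq (Fp L) L a)) (undoubledSplittings L (Equiv.prodUnique (Fin 1) (Fin 1)) dV₁ hdV₁ hdV0₁ (lineW L (TW (Fp L) a)) (complexConj_lineW L (TW (Fp L) a)) (lineW_ne_zero L (TW (Fp L) a) (isUnit_det_TW (Fp L) a)) (toHeckeCharacter L lam) (borelPlaceMeasure L) (cmFinLocalFamily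 L (Equiv.prodUnique (Fin 1) (Fin 1)) dV₁ hdV₁ hdV0₁ (lineW L (TW (Fp L) a)) (complexConj_lineW L (TW (Fp L) a)) (lineW_ne_zero L (TW (Fp L) a) (isUnit_det_TW (Fp L) a)) (toHeckeCharacter L lam) ((isOscillatorChar_toHeckeCharacter_iff lam).mpr hlam) (borelPlaceMeasure L))) (isSymm_TW (Fp L) a) (JW_eq (Fp L) L a)).proj_s v))) id (fun k => ((ξ k : ℂˣ) : ℂ))) = 0) :
    LineThetaTypesComplementary₁ := by
  intro L _ _ _ dV₁ hdV₁ hdV0₁ lam hlam a a' v hns hg ξ hξ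
  exact finrank_add_eq_one_of_disjoint_cm L dV₁ hdV₁ hdV0₁ lam hlam a a' v hns hg (h L dV₁ hdV₁ hdV0₁ lam hlam a a' v hns hg) ξ hξ

set_option synthInstance.maxHeartbeats 400000 in
set_option maxHeartbeats 4000000 in -- the CM θ-package section terms (as ★ `F0LD2LineThetaTypesComplementaryDefs`, 4 M)
/-- **THE ORGAN'S BODY AT `v` FROM COINVARIANT DISJOINTNESS AT `v`** (same as `finrank_add_eq_one_of_disjoint_cm`, the disjointness hypothesis read in
the coinvariant currency of ★ `LocalDoubledBlockTypesDuality`: no open-kernel `ξ` of `U(diag dV₁)(L⁺_v)` has both `Coinv_ξ(ω_{s_{a′}}) ≠ 0` and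
`Coinv_ξ(ω_{s_a}) ≠ 0`). [cite: MoeglinVignerasWaldspurger1987, Chap. 3 §IV.4 Théorème principal] [cite: HarrisKudlaSweet1996, Cor. 4.4 p. 962]
[cite: Liu2021, App. D Lemma D.1 (4) (p. 126)] -/
theorem finrank_add_eq_one_of_coinv_disjoint_cm (L : Type) [Field L] [NumberField L] [IsCMField L]
    (dV₁ : Fin 1 → L) (hdV₁ : ∀ i, IsCMField.complexConj L (dV₁ i) = dV₁ i) (hdV0₁ : ∀ i, dV₁ i ≠ 0)
    (lam : Literature.NumberTheory.Automorphic.IdeleClassGroup L →ₜ* Circle) (hlam : IsConjugateSymplectic L lam)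
    (a a' : (↥(maximalRealSubfield L))ˣ) (v : HeightOneSpectrum (𝓞 ↥(maximalRealSubfield L)))
    (hns : ∀ w : UnitaryGroup.PlacesOver L v, IsCMField.complexConj L • (w : HeightOneSpectrum (𝓞 L)) = w)
    (hg : ¬ ∃ x : (LocalRing L v)ˣ, LemD1OfPlace.eps L v (lineDelta_ne_zero (imagUnit_ne_zero L) a) =
        x * Units.map (conjLocal L (IsCMField.complexConj L) v : LocalRing L v →* LocalRing L v) x *
          LemD1OfPlace.eps L v (lineDelta_ne_zero (imagUnit_ne_zero L) a'))
    (hdisj : ∀ ξ : (localPi L (IsCMField.complexConj L) 1 (Matrix.diagonal dV₁) v) →* ℂˣ,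
      IsOpen (ξ.ker : Set (localPi L (IsCMField.complexConj L) 1 (Matrix.diagonal dV₁) v)) →
      Nontrivial (TwistedCoinv.Coinv ((MpPsi.toRep (localSchrodinger (Fp L) 1 (realDiagonal L dV₁ hdV₁) v)).comp
          (lineTransportSection (Fp L) L (IsCMField.complexConj L) 1 (complexConj_imagUnit L) (imagUnit_ne_zero L) (imagUnit_mul_self L) (realDiagonal L dV₁ hdV₁) (realDiagonal_isSymm L dV₁ hdV₁) (Matrix.diagonal dV₁) (realDiagonal_map L dV₁ hdV₁).symm a' v ((congrW L (Equiv.prodUnique (Fin 1) (Fin 1)) dV₁ hdV₁ (lineW L (TW (Fp L) a')) (complexConj_lineW L (TW (Fp L) a')) (realDiagonal_lineW L (TW (Fp L) a')) (diagonal_lineW L (TW (Fp L) a') (JW_eq (Fp L) L a')) (undoubledSplittings L (Equiv.prodUnique (Fin 1) (Fin 1)) dV₁ hdV₁ hdV0₁ (lineW L (TW (Fp L) a')) (complexConj_lineW L (TW (Fp L) a')) (lineW_ne_zero L (TW (Fp L) a') (isUnit_det_TW (Fp L) a')) (toHeckeCharacter L lam) (borelPlaceMeasure L) (cmFinLocalFamily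 L (Equiv.prodUnique (Fin 1) (Fin 1)) dV₁ hdV₁ hdV0₁ (lineW L (TW (Fp L) a')) (complexConj_lineW L (TW (Fp L) a')) (lineW_ne_zero L (TW (Fp L) a') (isUnit_det_TW (Fp L) a')) (toHeckeCharacter L lam) ((isOscillatorChar_toHeckeCharacter_iff lam).mpr hlam) (borelPlaceMeasure L))) (isSymm_TW (Fp L) a') (JW_eq (Fp L) L a')).s v) ((congrW L (Equiv.prodUnique (Fin 1) (Fin 1)) dV₁ hdV₁ (lineW L (TW (Fp L) a')) (complexConj_lineW L (TW (Fp L) a')) (realDiagonal_lineW L (TW (Fp L) a')) (diagonal_lineW L (TW (Fp L) a') (JW_eq (Fp L) L a')) (undoubledSplittings L (Equiv.prodUnique (Fin 1) (Fin 1)) dV₁ hdV₁ hdV0₁ (lineW L (TW (Fp L) a')) (complexConj_lineW L (TW (Fp L) a')) (lineW_ne_zero L (TW (Fp L) a') (isUnit_det_TW (Fp L) a')) (toHeckeCharacter L lam) (borelPlaceMeasure L) (cmFinLocalFamily L (Equiv.prodUnique (Fin 1) (Fin 1)) dV₁ hdV₁ hdV0₁ (lineW L (TW (Fp L) a')) (complexConj_lineW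 L (TW (Fp L) a')) (lineW_ne_zero L (TW (Fp L) a') (isUnit_det_TW (Fp L) a')) (toHeckeCharacter L lam) ((isOscillatorChar_toHeckeCharacter_iff lam).mpr hlam) (borelPlaceMeasure L))) (isSymm_TW (Fp L) a') (JW_eq (Fp L) L a')).proj_s v))) ξ) →
        Nontrivial (TwistedCoinv.Coinv ((MpPsi.toRep (localSchrodinger (Fp L) 1 (realDiagonal L dV₁ hdV₁) v)).comp
          (lineTransportSection (Fp L) L (IsCMField.complexConj L) 1 (complexConj_imagUnit L) (imagUnit_ne_zero L) (imagUnit_mul_self L) (realDiagonal L dV₁ hdV₁) (realDiagonal_isSymm L dV₁ hdV₁) (Matrix.diagonal dV₁) (realDiagonal_map L dV₁ hdV₁).symm a v ((congrW L (Equiv.prodUnique (Fin 1) (Fin 1)) dV₁ hdV₁ (lineW L (TW (Fp L) a)) (complexConj_lineW L (TW (Fp L) a)) (realDiagonal_lineW L (TW (Fp L) a)) (diagonal_lineW L (TW (Fp L) a) (JW_eq (Fp L) L a)) (undoubledSplittings L (Equiv.prodUnique (Fin 1) (Fin 1)) dV₁ hdV₁ hdV0₁ (lineW L (TW (Fp L)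 a)) (complexConj_lineW L (TW (Fp L) a)) (lineW_ne_zero L (TW (Fp L) a) (isUnit_det_TW (Fp L) a)) (toHeckeCharacter L lam) (borelPlaceMeasure L) (cmFinLocalFamily L (Equiv.prodUnique (Fin 1) (Fin 1)) dV₁ hdV₁ hdV0₁ (lineW L (TW (Fp L) a)) (complexConj_lineW L (TW (Fp L) a)) (lineW_ne_zero L (TW (Fp L) a) (isUnit_det_TW (Fp L) a)) (toHeckeCharacter L lam) ((isOscillatorChar_toHeckeCharacter_iff lam).mpr hlam) (borelPlaceMeasure L))) (isSymm_TW (Fp L) a) (JW_eq (Fp L) L a)).s v) ((congrW L (Equiv.prodUnique (Fin 1) (Fin 1)) dV₁ hdV₁ (lineW L (TW (Fp L) a)) (complexConj_lineW L (TW (Fp L) a)) (realDiagonal_lineW L (TW (Fp L) a)) (diagonal_lineW L (TW (Fp L) a) (JW_eq (Fp L) L a)) (undoubledSplittings L (Equiv.prodUnique (Fin 1) (Fin 1)) dV₁ hdV₁ hdV0₁ (lineW L (TW (Fp L) a)) (complexConj_lineW L (TW (Fp L) a)) (lineW_ne_zero L (TW (Fp L) a) (isUnit_det_TW (Fp L)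 a)) (toHeckeCharacter L lam) (borelPlaceMeasure L) (cmFinLocalFamily L (Equiv.prodUnique (Fin 1) (Fin 1)) dV₁ hdV₁ hdV0₁ (lineW L (TW (Fp L) a)) (complexConj_lineW L (TW (Fp L) a)) (lineW_ne_zero L (TW (Fp L) a) (isUnit_det_TW (Fp L) a)) (toHeckeCharacter L lam) ((isOscillatorChar_toHeckeCharacter_iff lam).mpr hlam) (borelPlaceMeasure L))) (isSymm_TW (Fp L) a) (JW_eq (Fp L) L a)).proj_s v))) ξ) → False)
    (ξ : (localPi L (IsCMField.complexConj L) 1 (Matrix.diagonal dV₁) v) →* ℂˣ)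
    (hξ : IsOpen (ξ.ker : Set (localPi L (IsCMField.complexConj L) 1 (Matrix.diagonal dV₁) v))) :
    Module.finrank ℂ (weightSpace ((MpPsi.toRep (localSchrodinger (Fp L) 1 (realDiagonal L dV₁ hdV₁) v)).comp
          (lineTransportSection (Fp L) L (IsCMField.complexConj L) 1 (complexConj_imagUnit L) (imagUnit_ne_zero L) (imagUnit_mul_self L) (realDiagonal L dV₁ hdV₁) (realDiagonal_isSymm L dV₁ hdV₁) (Matrix.diagonal dV₁) (realDiagonal_map L dV₁ hdV₁).symm a' v ((congrW L (Equiv.prodUnique (Fin 1) (Fin 1)) dV₁ hdV₁ (lineW L (TW (Fp L) a')) (complexConj_lineW L (TW (Fp L) a')) (realDiagonal_lineW L (TW (Fp L) a')) (diagonal_lineW L (TW (Fp L) a') (JW_eq (Fp L) L a')) (undoubledSplittings L (Equiv.prodUnique (Fin 1) (Fin 1)) dV₁ hdV₁ hdV0₁ (lineW L (TW (Fp L) a')) (complexConj_lineW L (TW (Fp L) a')) (lineW_ne_zero L (TW (Fp L) a') (isUnit_det_TW (Fp L) a')) (toHeckeCharacter L lam) (borelPlaceMeasure L) (cmFinLocalFamily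 L (Equiv.prodUnique (Fin 1) (Fin 1)) dV₁ hdV₁ hdV0₁ (lineW L (TW (Fp L) a')) (complexConj_lineW L (TW (Fp L) a')) (lineW_ne_zero L (TW (Fp L) a') (isUnit_det_TW (Fp L) a')) (toHeckeCharacter L lam) ((isOscillatorChar_toHeckeCharacter_iff lam).mpr hlam) (borelPlaceMeasure L))) (isSymm_TW (Fp L) a') (JW_eq (Fp L) L a')).s v) ((congrW L (Equiv.prodUnique (Fin 1) (Fin 1)) dV₁ hdV₁ (lineW L (TW (Fp L) a')) (complexConj_lineW L (TW (Fp L) a')) (realDiagonal_lineW L (TW (Fp L) a')) (diagonal_lineW L (TW (Fp L) a') (JW_eq (Fp L) L a')) (undoubledSplittings L (Equiv.prodUnique (Fin 1) (Fin 1)) dV₁ hdV₁ hdV0₁ (lineW L (TW (Fp L) a')) (complexConj_lineW L (TW (Fp L) a')) (lineW_ne_zero L (TW (Fp L) a') (isUnit_det_TW (Fp L) a')) (toHeckeCharacter L lam) (borelPlaceMeasure L) (cmFinLocalFamily L (Equiv.prodUnique (Fin 1) (Fin 1)) dV₁ hdV₁ hdV0₁ (lineW L (TW (Fp L) a')) (complexConj_lineW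 L (TW (Fp L) a')) (lineW_ne_zero L (TW (Fp L) a') (isUnit_det_TW (Fp L) a')) (toHeckeCharacter L lam) ((isOscillatorChar_toHeckeCharacter_iff lam).mpr hlam) (borelPlaceMeasure L))) (isSymm_TW (Fp L) a') (JW_eq (Fp L) L a')).proj_s v))) id (fun k => ((ξ k : ℂˣ) : ℂ))) +
      Module.finrank ℂ (weightSpace ((MpPsi.toRep (localSchrodinger (Fp L) 1 (realDiagonal L dV₁ hdV₁) v)).comp
          (lineTransportSection (Fp L) L (IsCMField.complexConj L) 1 (complexConj_imagUnit L) (imagUnit_ne_zero L) (imagUnit_mul_self L) (realDiagonal L dV₁ hdV₁) (realDiagonal_isSymm L dV₁ hdV₁) (Matrix.diagonal dV₁) (realDiagonal_map L dV₁ hdV₁).symm a v ((congrW L (Equiv.prodUnique (Fin 1) (Fin 1)) dV₁ hdV₁ (lineW L (TW (Fp L) a)) (complexConj_lineW L (TW (Fp L) a)) (realDiagonal_lineW L (TW (Fp L) a)) (diagonal_lineW L (TW (Fp L) a) (JW_eq (Fp L) L a)) (undoubledSplittings L (Equiv.prodUnique (Fin 1) (Fin 1)) dV₁ hdV₁ hdV0₁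 (lineW L (TW (Fp L) a)) (complexConj_lineW L (TW (Fp L) a)) (lineW_ne_zero L (TW (Fp L) a) (isUnit_det_TW (Fp L) a)) (toHeckeCharacter L lam) (borelPlaceMeasure L) (cmFinLocalFamily L (Equiv.prodUnique (Fin 1) (Fin 1)) dV₁ hdV₁ hdV0₁ (lineW L (TW (Fp L) a)) (complexConj_lineW L (TW (Fp L) a)) (lineW_ne_zero L (TW (Fp L) a) (isUnit_det_TW (Fp L) a)) (toHeckeCharacter L lam) ((isOscillatorChar_toHeckeCharacter_iff lam).mpr hlam) (borelPlaceMeasure L))) (isSymm_TW (Fp L) a) (JW_eq (Fp L) L a)).s v) ((congrW L (Equiv.prodUnique (Fin 1) (Fin 1)) dV₁ hdV₁ (lineW L (TW (Fp L) a)) (complexConj_lineW L (TW (Fp L) a)) (realDiagonal_lineW L (TW (Fp L) a)) (diagonal_lineW L (TW (Fp L) a) (JW_eq (Fp L) L a)) (undoubledSplittings L (Equiv.prodUnique (Fin 1) (Fin 1)) dV₁ hdV₁ hdV0₁ (lineW L (TW (Fp L) a)) (complexConj_lineW L (TW (Fp L) a)) (lineW_ne_zero L (TW (Fp L) a) (isUnit_det_TW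 (Fp L) a)) (toHeckeCharacter L lam) (borelPlaceMeasure L) (cmFinLocalFamily L (Equiv.prodUnique (Fin 1) (Fin 1)) dV₁ hdV₁ hdV0₁ (lineW L (TW (Fp L) a)) (complexConj_lineW L (TW (Fp L) a)) (lineW_ne_zero L (TW (Fp L) a) (isUnit_det_TW (Fp L) a)) (toHeckeCharacter L lam) ((isOscillatorChar_toHeckeCharacter_iff lam).mpr hlam) (borelPlaceMeasure L))) (isSymm_TW (Fp L) a) (JW_eq (Fp L) L a)).proj_s v))) id (fun k => ((ξ k : ℂˣ) : ℂ))) = 1 := by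
  have hE : IsField (UnitaryGroup.LocalRing L v) := isField_localRing_cm_of_forall_smul_eq L v hns
  have hN := not_isNorm_of_eps_guard (Fp L) L (IsCMField.complexConj L) (imagUnit_ne_zero L) v a a' hg
  have hcls := _root_.Summit.HodgeConjecture.HodgeConjecture.Cruxes.H413.F0P2oU1DichotomyTransport.hilbertSymbol_eq_neg_one_of_not_isNorm
    (Fp L) L (IsCMField.complexConj L)
    (complexConj_imagUnit L) (imagUnit_ne_zero L) (imagUnit_mul_self L) v hE (a⁻¹ * a').ne_zero hN
  rw [show (a⁻¹ * a' : (Fp L)ˣ) = a' * a⁻¹ from mul_comm _ _] at hcls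
  have key := finrank_weightSpace_add_eq_one_of_coinv_disjoint_lines (Fp L) L (IsCMField.complexConj L) (complexConj_imagUnit L) (imagUnit_ne_zero L)
    (imagUnit_mul_self L) (realDiagonal L dV₁ hdV₁) (realDiagonal_isSymm L dV₁ hdV₁) (isUnit_det_realDiagonal L dV₁ hdV₁ hdV0₁) (Matrix.diagonal dV₁)
    (realDiagonal_map L dV₁ hdV₁).symm v hE a a'
    (congrW L (Equiv.prodUnique (Fin 1) (Fin 1)) dV₁ hdV₁ (lineW L (TW (Fp L) a)) (complexConj_lineW L (TW (Fp L) a)) (realDiagonal_lineW L (TW (Fp L) a)) (diagonal_lineW L (TW (Fp L) a) (JW_eq (Fp L) L a)) (undoubledSplittings L (Equiv.prodUnique (Fin 1) (Fin 1)) dV₁ hdV₁ hdV0₁ (lineW L (TW (Fp L) a)) (complexConj_lineW L (TW (Fp L) a)) (lineW_ne_zero L (TW (Fp L) a) (isUnit_det_TW (Fp L) a)) (toHeckeCharacter L lam) (borelPlaceMeasure L) (cmFinLocalFamily L (Equiv.prodUnique (Fin 1) (Fin 1)) dV₁ hdV₁ hdV0₁ (lineW L (TW (Fp L) a)) (complexConj_lineW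 L (TW (Fp L) a)) (lineW_ne_zero L (TW (Fp L) a) (isUnit_det_TW (Fp L) a)) (toHeckeCharacter L lam) ((isOscillatorChar_toHeckeCharacter_iff lam).mpr hlam) (borelPlaceMeasure L))) (isSymm_TW (Fp L) a) (JW_eq (Fp L) L a))
    (congrW L (Equiv.prodUnique (Fin 1) (Fin 1)) dV₁ hdV₁ (lineW L (TW (Fp L) a')) (complexConj_lineW L (TW (Fp L) a')) (realDiagonal_lineW L (TW (Fp L) a')) (diagonal_lineW L (TW (Fp L) a') (JW_eq (Fp L) L a')) (undoubledSplittings L (Equiv.prodUnique (Fin 1) (Fin 1)) dV₁ hdV₁ hdV0₁ (lineW L (TW (Fp L) a')) (complexConj_lineW L (TW (Fp L) a')) (lineW_ne_zero L (TW (Fp L) a') (isUnit_det_TW (Fp L) a')) (toHeckeCharacter L lam) (borelPlaceMeasure L) (cmFinLocalFamily L (Equiv.prodUnique (Fin 1) (Fin 1)) dV₁ hdV₁ hdV0₁ (lineW L (TW (Fp L) a')) (complexConj_lineW L (TW (Fp L) a')) (lineW_ne_zero L (TW (Fp L) a') (isUnit_det_TW (Fp L) a')) (toHeckeCharacter L lam)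 ((isOscillatorChar_toHeckeCharacter_iff lam).mpr hlam) (borelPlaceMeasure L))) (isSymm_TW (Fp L) a') (JW_eq (Fp L) L a'))
    hcls (fun χ hχ h₁ h₂ => hdisj χ hχ h₂ h₁) ξ hξ
  omega

set_option synthInstance.maxHeartbeats 400000 in
set_option maxHeartbeats 4000000 in -- the CM θ-package section terms (as ★ `F0LD2LineThetaTypesComplementaryDefs`, 4 M)
/-- **THE ORGAN FROM COINVARIANT DISJOINTNESS**: if at every non-split guarded place no open-kernel character of `L_v¹` has non-zero coinvariants in BOTH
same-`λ` rank-one line representations, then ★ `LineThetaTypesComplementary₁` holds (closed form of `finrank_add_eq_one_of_coinv_disjoint_cm`; hypothesis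
spelled out on the organ's tokens, no new definition). [cite: MoeglinVignerasWaldspurger1987, Chap. 3 §IV.4 Théorème principal]
[cite: HarrisKudlaSweet1996, Cor. 4.4 p. 962] [cite: Liu2021, App. D Lemma D.1 (4) (p. 126)] -/
theorem lineThetaTypesComplementary₁_of_coinv_disjoint
    (h : ∀ (L : Type) [Field L] [NumberField L] [IsCMField L]
    (dV₁ : Fin 1 → L) (hdV₁ : ∀ i, IsCMField.complexConj L (dV₁ i) = dV₁ i) (hdV0₁ : ∀ i, dV₁ i ≠ 0)
    (lam : Literature.NumberTheory.Automorphic.IdeleClassGroup L →ₜ* Circle) (hlam : IsConjugateSymplectic L lam)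
    (a a' : (↥(maximalRealSubfield L))ˣ) (v : HeightOneSpectrum (𝓞 ↥(maximalRealSubfield L))),
    (∀ w : UnitaryGroup.PlacesOver L v, IsCMField.complexConj L • (w : HeightOneSpectrum (𝓞 L)) = w) →
    (¬ ∃ x : (LocalRing L v)ˣ, LemD1OfPlace.eps L v (lineDelta_ne_zero (imagUnit_ne_zero L) a) =
        x * Units.map (conjLocal L (IsCMField.complexConj L) v : LocalRing L v →* LocalRing L v) x *
          LemD1OfPlace.eps L v (lineDelta_ne_zero (imagUnit_ne_zero L) a')) →
    ∀ ξ : (localPi L (IsCMField.complexConj L) 1 (Matrix.diagonal dV₁) v) →* ℂˣ,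
      IsOpen (ξ.ker : Set (localPi L (IsCMField.complexConj L) 1 (Matrix.diagonal dV₁) v)) →
      Nontrivial (TwistedCoinv.Coinv ((MpPsi.toRep (localSchrodinger (Fp L) 1 (realDiagonal L dV₁ hdV₁) v)).comp
          (lineTransportSection (Fp L) L (IsCMField.complexConj L) 1 (complexConj_imagUnit L) (imagUnit_ne_zero L) (imagUnit_mul_self L) (realDiagonal L dV₁ hdV₁) (realDiagonal_isSymm L dV₁ hdV₁) (Matrix.diagonal dV₁) (realDiagonal_map L dV₁ hdV₁).symm a' v ((congrW L (Equiv.prodUnique (Fin 1) (Fin 1)) dV₁ hdV₁ (lineW L (TW (Fp L) a')) (complexConj_lineW L (TW (Fp L) a')) (realDiagonal_lineW L (TW (Fp L) a')) (diagonal_lineW L (TW (Fp L) a') (JW_eq (Fp L) L a')) (undoubledSplittings L (Equiv.prodUnique (Fin 1) (Fin 1)) dV₁ hdV₁ hdV0₁ (lineW L (TW (Fp L) a')) (complexConj_lineW L (TW (Fp L) a')) (lineW_ne_zero L (TW (Fp L) a') (isUnit_det_TW (Fp L) a')) (toHeckeCharacter L lam) (borelPlaceMeasure L) (cmFinLocalFamily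 L (Equiv.prodUnique (Fin 1) (Fin 1)) dV₁ hdV₁ hdV0₁ (lineW L (TW (Fp L) a')) (complexConj_lineW L (TW (Fp L) a')) (lineW_ne_zero L (TW (Fp L) a') (isUnit_det_TW (Fp L) a')) (toHeckeCharacter L lam) ((isOscillatorChar_toHeckeCharacter_iff lam).mpr hlam) (borelPlaceMeasure L))) (isSymm_TW (Fp L) a') (JW_eq (Fp L) L a')).s v) ((congrW L (Equiv.prodUnique (Fin 1) (Fin 1)) dV₁ hdV₁ (lineW L (TW (Fp L) a')) (complexConj_lineW L (TW (Fp L) a')) (realDiagonal_lineW L (TW (Fp L) a')) (diagonal_lineW L (TW (Fp L) a') (JW_eq (Fp L) L a')) (undoubledSplittings L (Equiv.prodUnique (Fin 1) (Fin 1)) dV₁ hdV₁ hdV0₁ (lineW L (TW (Fp L) a')) (complexConj_lineW L (TW (Fp L) a')) (lineW_ne_zero L (TW (Fp L) a') (isUnit_det_TW (Fp L) a')) (toHeckeCharacter L lam) (borelPlaceMeasure L) (cmFinLocalFamily L (Equiv.prodUnique (Fin 1) (Fin 1)) dV₁ hdV₁ hdV0₁ (lineW L (TW (Fp L) a')) (complexConj_lineW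 L (TW (Fp L) a')) (lineW_ne_zero L (TW (Fp L) a') (isUnit_det_TW (Fp L) a')) (toHeckeCharacter L lam) ((isOscillatorChar_toHeckeCharacter_iff lam).mpr hlam) (borelPlaceMeasure L))) (isSymm_TW (Fp L) a') (JW_eq (Fp L) L a')).proj_s v))) ξ) →
        Nontrivial (TwistedCoinv.Coinv ((MpPsi.toRep (localSchrodinger (Fp L) 1 (realDiagonal L dV₁ hdV₁) v)).comp
          (lineTransportSection (Fp L) L (IsCMField.complexConj L) 1 (complexConj_imagUnit L) (imagUnit_ne_zero L) (imagUnit_mul_self L) (realDiagonal L dV₁ hdV₁) (realDiagonal_isSymm L dV₁ hdV₁) (Matrix.diagonal dV₁) (realDiagonal_map L dV₁ hdV₁).symm a v ((congrW L (Equiv.prodUnique (Fin 1) (Fin 1)) dV₁ hdV₁ (lineW L (TW (Fp L) a)) (complexConj_lineW L (TW (Fp L) a)) (realDiagonal_lineW L (TW (Fp L) a)) (diagonal_lineW L (TW (Fp L) a) (JW_eq (Fp L) L a)) (undoubledSplittings L (Equiv.prodUnique (Fin 1) (Fin 1)) dV₁ hdV₁ hdV0₁ (lineW L (TW (Fp L)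 a)) (complexConj_lineW L (TW (Fp L) a)) (lineW_ne_zero L (TW (Fp L) a) (isUnit_det_TW (Fp L) a)) (toHeckeCharacter L lam) (borelPlaceMeasure L) (cmFinLocalFamily L (Equiv.prodUnique (Fin 1) (Fin 1)) dV₁ hdV₁ hdV0₁ (lineW L (TW (Fp L) a)) (complexConj_lineW L (TW (Fp L) a)) (lineW_ne_zero L (TW (Fp L) a) (isUnit_det_TW (Fp L) a)) (toHeckeCharacter L lam) ((isOscillatorChar_toHeckeCharacter_iff lam).mpr hlam) (borelPlaceMeasure L))) (isSymm_TW (Fp L) a) (JW_eq (Fp L) L a)).s v) ((congrW L (Equiv.prodUnique (Fin 1) (Fin 1)) dV₁ hdV₁ (lineW L (TW (Fp L) a)) (complexConj_lineW L (TW (Fp L) a)) (realDiagonal_lineW L (TW (Fp L) a)) (diagonal_lineW L (TW (Fp L) a) (JW_eq (Fp L) L a)) (undoubledSplittings L (Equiv.prodUnique (Fin 1) (Fin 1)) dV₁ hdV₁ hdV0₁ (lineW L (TW (Fp L) a)) (complexConj_lineW L (TW (Fp L) a)) (lineW_ne_zero L (TW (Fp L) a) (isUnit_det_TW (Fp L)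 a)) (toHeckeCharacter L lam) (borelPlaceMeasure L) (cmFinLocalFamily L (Equiv.prodUnique (Fin 1) (Fin 1)) dV₁ hdV₁ hdV0₁ (lineW L (TW (Fp L) a)) (complexConj_lineW L (TW (Fp L) a)) (lineW_ne_zero L (TW (Fp L) a) (isUnit_det_TW (Fp L) a)) (toHeckeCharacter L lam) ((isOscillatorChar_toHeckeCharacter_iff lam).mpr hlam) (borelPlaceMeasure L))) (isSymm_TW (Fp L) a) (JW_eq (Fp L) L a)).proj_s v))) ξ) → False) :
    LineThetaTypesComplementary₁ := by
  intro L _ _ _ dV₁ hdV₁ hdV0₁ lam hlam a a' v hns hg ξ hξ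
  exact finrank_add_eq_one_of_coinv_disjoint_cm L dV₁ hdV₁ hdV0₁ lam hlam a a' v hns hg (h L dV₁ hdV₁ hdV0₁ lam hlam a a' v hns hg) ξ hξ

end Summit.HodgeConjecture.HodgeConjecture.Cruxes.HLiu418.F0LD2LineComplementaryOfDisjoint

end
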